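import Summits.ResolutionOfSingularities.ResolutionOfSingularities.Theorems.MarkedTransferCampaignW46CuspArc
import Mathlib.RingTheory.MvPolynomial.Ideal
import HarnessLib

/-!
# [OURS · L0 K4.6 / slot W4.6] The cusp `(yᵖ + xⁿ, p)`, II: NO HYPERSURFACE OF IDEALISTIC MAXIMAL CONTACT and no
# `x̄^q` edge generator, for EVERY prime `p` and every `n > p`, `p ∤ n` — kernel form of kill test K4.6, column (B),
# over the TYPED algebraic characteristic algebra `S04CharAlgebra.pAlgebraicRing` (cell res-hironaka,
# LADDER-RESOLUTION rung L, D-0089; seat res-L0-k46; host route MarkedTransfer,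
# `--supports stmt-ResolutionOfSingularities-16155`)

HONEST FRAMING. Nothing here is a statement of H. Hironaka's manuscript (2017-03-23, [Hironaka2017]) and nothing
here asserts that any statement of it holds. The objects are the tree's REAL definitions (`Resolution.diffIdeal`,
EGA IV₄ 16.8) and the typed CANDIDATE definition of row 003, `S04CharAlgebra.pAlgebraicRing K O J b` (the ALGEBRAIC
definition U17_2 of `℘(E)`, p.17 l.8–11, ring level) with its degree pieces `S04CharAlgebra.homogPiece`. The theorems
below are elementary commutative algebra about these definitions for ONE family of inputs (tag [folklore]); they replace
the role of the level-0 data «`℘(K_{p,n},1)` has no element of order 1» and «no element of `℘(K_{p,n},q)` has initial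
form `x̄^q`» of the K4.6 report (`run/shared/lean/pub/res-hironaka/L/res-L0-k46/KILL-TEST-K4.6.md` §3.1 (iii)–(iv), there
for `p ≤ 7`, `n ≤ 30`, `q ≤ 64` by LSB exit-word certificates (kit j258573), §3.2 for all `p` on paper); NOT a
statement of the manuscript. The bridge from the algebraic `℘` to the geometric one (THE carrier `S04CharAlgebra.pAlg`,
through which `Inv` of Eq. (34) is typed) is the typed candidate `U17_4` = the manuscript's import [23] (Hironaka
2003) and is NOT claimed; the reading «hence `Inv_ξ = (2,1,p)` at every singular cusp stage, so the typed 0-padded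
string of Eq. (127) cannot drop between two singular stages» is the report's (Th. 4.19 / Eq. (34) as transcribed
there), not proved here. AI review is weaker than expert review. No `sorry`; axioms standard. The arc lemma used
below is `Theorems/MarkedTransferCampaignW46CuspArc.lean` (`Cusp.arc_dvd_of_monomial_mem`).

## What is proved (`K` any field of characteristic `p`, `p` prime, `p < n`, `p ∤ n`; `O = K[x,y]`, `x = X 0`, `y = X 1`,
## `℘alg = pAlgebraicRing K O (yᵖ + xⁿ) p ⊆ O[X]`, `℘alg(E,a) = homogPiece O ℘alg a = {h | h·X^a ∈ ℘alg}`)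

* `homogPiece_one_le_idealOfVars_sq` — **no idealistic maximal contact (algebraic reading)**: `℘alg(E,1) ⊆ (x,y)²`;
  no element of the degree-one piece has order `≤ 1` at the origin, so no regular parameter / smooth curve germ
  through `0` lies in it. (Arc weights of `1, x, y` are `0, p(p−1), n(p−1) < p(n−1)` and no other monomial shares
  them — `eq_zero_of_weight_eq`, `eq_single_zero_of_weight_eq`, `eq_single_one_of_weight_eq`; the last one is where
  `p ∤ n` enters.)
* `coeff_X_pow_eq_zero_of_mem_homogPiece` — **no `x̄^q` edge generator, every `q ≥ 1`**: an element of `℘alg(E,q)`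
  of order `≥ q` has zero coefficient at `x^q` (`x^q` is the only monomial of degree `≥ q` and arc weight
  `p(p−1)q < q·p(n−1)`; `p ∤ n` not needed).
* Plumbing: `coeff_arc` (coefficients of the arc image), `coeff_eq_zero_of_arc_dvd` (extraction of a coefficient
  from an arc-divisibility when its monomial is alone in its weight), the weight inequalities.

Barrier bookkeeping (K4.6 verdict ALIVE, barrier none): with `in(yᵖ + xⁿ) = ȳᵖ` (`Cusp.cusp_mem_homogPiece`) these
two theorems are the level-0 half of the barrier CANDIDATE «CuspStringStall(p)» offered to the operator in the report
§4, now for all `p`, `n`; this is not a barrier file.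

## References

* H. Hironaka, ms. 2017-03-23, §4 p.16 l.38 – p.18 l.20 (U17_1/U17_2/U17_4), Def. 4.6–4.9 p.19–20, Eq. (34) p.24 —
  scope only, under adjudication, not cited as fact. [Hironaka2017]
* A. Grothendieck, J. Dieudonné, ÉGA IV₄, Publ. Math. IHÉS 32 (1967), §16.8, Thm. 16.11.2. [EGAIV4]
* Cell res-hironaka: `L/res-L0-k46/KILL-TEST-K4.6.md` (K4.6, kit j258573; repro j258788/j259212/j259215; atlas j259568).
-/

noncomputable section

set_option linter.dupNamespace false -- mandated namespace of this single-conjunct summit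

namespace Summit.ResolutionOfSingularities.ResolutionOfSingularities.Theorems

namespace CampaignW46

namespace Cusp

open Literature.AlgebraicGeometry.Resolution
open Literature.AlgebraicGeometry.Hironaka2017.S04CharAlgebra
open MvPolynomial (X monomial)

universe u

variable {K : Type u} [Field K] {p n : ℕ}

/-! ## Arc weights `(p−1)·(p·β₀ + n·β₁)`: thresholds and uniqueness of the low monomials -/

/-- Arc weight of `1` is below the degree-`1` threshold: `0 < 1·p(n−1)` for `2 ≤ p < n`. [folklore] -/
theorem weight_zero_lt (hp : 2 ≤ p) (hpn : p < n) :
    (p - 1) * (p * (0 : Fin 2 →₀ ℕ) 0 + n * (0 : Fin 2 →₀ ℕ) 1) < 1 * (p * (n - 1)) := by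
  simp only [Finsupp.coe_zero, Pi.zero_apply, mul_zero, add_zero, one_mul]
  exact Nat.mul_pos (by omega) (by omega)

/-- Arc weight of `x^q` is below the degree-`q` threshold: `(p−1)·p·q < q·p(n−1)` for `2 ≤ p < n`, `1 ≤ q`.
[folklore] -/
theorem weight_single_zero_lt (hp : 2 ≤ p) (hpn : p < n) {q : ℕ} (hq : 1 ≤ q) :
    (p - 1) * (p * (Finsupp.single (0 : Fin 2) q) 0 + n * (Finsupp.single (0 : Fin 2) q) 1) <
      q * (p * (n - 1)) := by
  have h1 : (Finsupp.single (0 : Fin 2) q) 0 = q := Finsupp.single_eq_same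
  have h2 : (Finsupp.single (0 : Fin 2) q) 1 = 0 := by simp
  rw [h1, h2]
  obtain ⟨u, rfl⟩ : ∃ u, p = u + 1 := ⟨p - 1, by omega⟩
  obtain ⟨v, rfl⟩ : ∃ v, n = v + 1 := ⟨n - 1, by omega⟩
  simp only [Nat.add_sub_cancel]
  have huv : u < v := by omega
  calc u * ((u + 1) * q + (v + 1) * 0) = (q * (u + 1)) * u := by ring
    _ < (q * (u + 1)) * v := (Nat.mul_lt_mul_left (Nat.mul_pos (by omega) (by omega))).mpr huv
    _ = q * ((u + 1) * v) := by ring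

/-- Arc weight of `y` is below the degree-`1` threshold: `(p−1)·n < p(n−1)` iff `p < n`. [folklore] -/
theorem weight_single_one_lt (hp : 2 ≤ p) (hpn : p < n) :
    (p - 1) * (p * (Finsupp.single (1 : Fin 2) 1) 0 + n * (Finsupp.single (1 : Fin 2) 1) 1) <
      1 * (p * (n - 1)) := by
  have h1 : (Finsupp.single (1 : Fin 2) 1) 0 = 0 := by simp
  have h2 : (Finsupp.single (1 : Fin 2) 1) 1 = 1 := Finsupp.single_eq_same
  rw [h1, h2]
  obtain ⟨u, rfl⟩ : ∃ u, p = u + 1 := ⟨p - 1, by omega⟩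
  obtain ⟨v, rfl⟩ : ∃ v, n = v + 1 := ⟨n - 1, by omega⟩
  simp only [Nat.add_sub_cancel]
  have huv : u < v := by omega
  have e1 : u * ((u + 1) * 0 + (v + 1) * 1) = u * v + u := by ring
  have e2 : 1 * ((u + 1) * v) = u * v + v := by ring
  rw [e1, e2]
  omega

/-- Weight `0` is attained only by the monomial `1`. [folklore] -/
theorem eq_zero_of_weight_eq (hp : 2 ≤ p) (hn : 1 ≤ n) {β : Fin 2 →₀ ℕ}
    (h : (p - 1) * (p * β 0 + n * β 1) = (p - 1) * (p * (0 : Fin 2 →₀ ℕ) 0 + n * (0 : Fin 2 →₀ ℕ) 1)) :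
    β = 0 := by
  simp only [Finsupp.coe_zero, Pi.zero_apply, mul_zero, add_zero] at h
  rcases Nat.mul_eq_zero.mp h with h' | h'
  · omega
  · have h0 : p * β 0 = 0 := by omega
    have h1 : n * β 1 = 0 := by omega
    have hb0 : β 0 = 0 := by
      rcases Nat.mul_eq_zero.mp h0 with h'' | h''
      · omega
      · exact h''
    have hb1 : β 1 = 0 := by
      rcases Nat.mul_eq_zero.mp h1 with h'' | h''
      · omega
      · exact h''
    ext i
    fin_cases i
    · simpa using hb0
    · simpa using hb1

/-- Weight `p(p−1)` is attained only by the monomial `x` (for `p < n`). [folklore] -/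
theorem eq_single_zero_of_weight_eq (hp : 2 ≤ p) (hpn : p < n) {β : Fin 2 →₀ ℕ}
    (h : (p - 1) * (p * β 0 + n * β 1) =
      (p - 1) * (p * (Finsupp.single (0 : Fin 2) 1) 0 + n * (Finsupp.single (0 : Fin 2) 1) 1)) :
    β = Finsupp.single 0 1 := by
  have h1 : (Finsupp.single (0 : Fin 2) 1) 0 = 1 := Finsupp.single_eq_same
  have h2 : (Finsupp.single (0 : Fin 2) 1) 1 = 0 := by simp
  rw [h1, h2] at h
  have h' : p * β 0 + n * β 1 = p * 1 + n * 0 := Nat.eq_of_mul_eq_mul_left (by omega) h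
  have hb1 : β 1 = 0 := by
    rcases Nat.eq_zero_or_pos (β 1) with h0 | hpos
    · exact h0
    · exfalso
      have : n ≤ n * β 1 := Nat.le_mul_of_pos_right n hpos
      omega
  have hb0 : β 0 = 1 := by
    rw [hb1] at h'
    have : p * β 0 = p * 1 := by omega
    exact Nat.eq_of_mul_eq_mul_left (by omega) this
  ext i
  fin_cases i
  · simpa using hb0
  · simpa using hb1

/-- Weight `n(p−1)` is attained only by the monomial `y` (for `p < n`, `p ∤ n`). [folklore] -/
theorem eq_single_one_of_weight_eq (hp : 2 ≤ p) (hpn : p < n) (hndvd : ¬ p ∣ n) {β : Fin 2 →₀ ℕ}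
    (h : (p - 1) * (p * β 0 + n * β 1) =
      (p - 1) * (p * (Finsupp.single (1 : Fin 2) 1) 0 + n * (Finsupp.single (1 : Fin 2) 1) 1)) :
    β = Finsupp.single 1 1 := by
  have h1 : (Finsupp.single (1 : Fin 2) 1) 0 = 0 := by simp
  have h2 : (Finsupp.single (1 : Fin 2) 1) 1 = 1 := Finsupp.single_eq_same
  rw [h1, h2] at h
  have h' : p * β 0 + n * β 1 = p * 0 + n * 1 := Nat.eq_of_mul_eq_mul_left (by omega) h
  have hb1 : β 1 = 1 := by
    rcases Nat.lt_trichotomy (β 1) 1 with hlt | heq | hgt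
    · exfalso
      have hb : β 1 = 0 := by omega
      rw [hb] at h'
      exact hndvd ⟨β 0, by omega⟩
    · exact heq
    · exfalso
      have : n * 2 ≤ n * β 1 := Nat.mul_le_mul_left n hgt
      omega
  have hb0 : β 0 = 0 := by
    rw [hb1] at h'
    have h0 : p * β 0 = 0 := by omega
    rcases Nat.mul_eq_zero.mp h0 with h'' | h''
    · omega
    · exact h''
  ext i
  fin_cases i
  · simpa using hb0
  · simpa using hb1

/-! ## Coefficients of the arc image -/

section Arc

variable (φ : MvPolynomial (Fin 2) K →ₐ[K] Polynomial K)

/-- The coefficient of `τ^k` in the arc image of `h` is the signed sum of the coefficients of `h` at the monomials of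
arc weight `k`. [folklore] -/
theorem coeff_arc (hφ0 : φ (X 0) = Polynomial.X ^ (p * (p - 1)))
    (hφ1 : φ (X 1) = -Polynomial.X ^ (n * (p - 1))) (h : MvPolynomial (Fin 2) K) (k : ℕ) :
    (φ h).coeff k = ∑ β ∈ h.support,
      if k = (p - 1) * (p * β 0 + n * β 1) then h.coeff β * (-1) ^ (β 1) else 0 := by
  classical
  conv_lhs => rw [h.as_sum, map_sum, Polynomial.finsetSum_coeff]
  refine Finset.sum_congr rfl fun β _ => ?_
  rw [arc_monomial φ hφ0 hφ1, Polynomial.coeff_C_mul_X_pow]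

/-- Extraction: if `τ^m` divides the arc image of `h` and `β₀` is the ONLY monomial of `h` of its arc weight, that
weight being `< m`, then the coefficient of `h` at `β₀` vanishes. [folklore] -/
theorem coeff_eq_zero_of_arc_dvd (hφ0 : φ (X 0) = Polynomial.X ^ (p * (p - 1)))
    (hφ1 : φ (X 1) = -Polynomial.X ^ (n * (p - 1))) {h : MvPolynomial (Fin 2) K} {m : ℕ}
    (hdvd : Polynomial.X ^ m ∣ φ h) (β₀ : Fin 2 →₀ ℕ) (hlt : (p - 1) * (p * β₀ 0 + n * β₀ 1) < m)
    (huniq : ∀ β ∈ h.support,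
      (p - 1) * (p * β 0 + n * β 1) = (p - 1) * (p * β₀ 0 + n * β₀ 1) → β = β₀) :
    h.coeff β₀ = 0 := by
  classical
  have hz : (φ h).coeff ((p - 1) * (p * β₀ 0 + n * β₀ 1)) = 0 :=
    Polynomial.X_pow_dvd_iff.mp hdvd _ hlt
  rw [coeff_arc φ hφ0 hφ1, Finset.sum_eq_single β₀, if_pos rfl] at hz
  · exact (mul_eq_zero.mp hz).resolve_right (pow_ne_zero _ (neg_ne_zero.mpr one_ne_zero))
  · intro β hβ hne
    exact if_neg fun heq => hne (huniq β hβ heq.symm)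
  · intro hβ₀
    rw [if_pos rfl, MvPolynomial.notMem_support_iff.mp hβ₀, zero_mul]

end Arc

/-! ## The two structural consequences -/

/-- [OURS · L0 K4.6; NOT a statement of the manuscript] **NO HYPERSURFACE OF IDEALISTIC MAXIMAL CONTACT FOR THE CUSP
`(yᵖ + xⁿ, p)`, ALGEBRAIC READING, EVERY PRIME `p`, EVERY `n > p` WITH `p ∤ n`:** the degree-one piece of the typed
algebraic characteristic algebra (`S04CharAlgebra.homogPiece _ (pAlgebraicRing K K[x,y] (yᵖ + xⁿ) p) 1`, i.e. the
`h` with `h·X ∈ ℘alg`) is contained in `(x, y)²` — it contains no element of order `≤ 1` at the origin, so no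
regular parameter / smooth curve germ through `0` generates a degree-one element. Replaces the role of the K4.6
level-0 datum «`℘(K_{p,n},1)` has no element of order 1» (KILL-TEST-K4.6.md §3.1 (iii), §3.2); NOT a statement of
the manuscript; the transfer to the geometric `℘` / `Inv` is `U17_4` ([23]), not claimed. [folklore] -/
theorem homogPiece_one_le_idealOfVars_sq [hp : Fact p.Prime] [CharP K p] (hpn : p < n) (hndvd : ¬ p ∣ n) :
    homogPiece (MvPolynomial (Fin 2) K)
        (pAlgebraicRing K (MvPolynomial (Fin 2) K) (Ideal.span {(X 1 ^ p + X 0 ^ n)}) p) 1 ≤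
      MvPolynomial.idealOfVars (Fin 2) K ^ 2 := by
  classical
  intro h hh
  have hp2 : 2 ≤ p := hp.out.two_le
  rw [homogPiece, Submodule.mem_comap, Subalgebra.mem_toSubmodule] at hh
  -- the arc
  set φ : MvPolynomial (Fin 2) K →ₐ[K] Polynomial K :=
    MvPolynomial.aeval ![(Polynomial.X : Polynomial K) ^ (p * (p - 1)), -Polynomial.X ^ (n * (p - 1))] with hφ
  have hφ0 : φ (X 0) = Polynomial.X ^ (p * (p - 1)) := by rw [hφ, MvPolynomial.aeval_X]; rfl
  have hφ1 : φ (X 1) = -Polynomial.X ^ (n * (p - 1)) := by rw [hφ, MvPolynomial.aeval_X]; rfl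
  have hdvd := arc_dvd_of_monomial_mem hpn φ hφ0 hφ1 hh
  rw [MvPolynomial.mem_pow_idealOfVars_iff']
  intro β hβ
  have hdeg : β 0 + β 1 ≤ 1 := by
    have h' := Finsupp.degree_eq_sum β
    rw [Fin.sum_univ_two] at h'
    omega
  by_cases h0 : β 0 = 0
  · by_cases h1 : β 1 = 0
    · have hβ0 : β = 0 := by
        ext i
        fin_cases i
        · simpa using h0
        · simpa using h1
      rw [hβ0]
      exact coeff_eq_zero_of_arc_dvd φ hφ0 hφ1 hdvd 0 (weight_zero_lt hp2 hpn)
        (fun β' _ h' => eq_zero_of_weight_eq hp2 (by omega) h')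
    · have hb1 : β 1 = 1 := by omega
      have hβ1 : β = Finsupp.single 1 1 := by
        ext i
        fin_cases i
        · simpa using h0
        · simpa using hb1
      rw [hβ1]
      exact coeff_eq_zero_of_arc_dvd φ hφ0 hφ1 hdvd _ (weight_single_one_lt hp2 hpn)
        (fun β' _ h' => eq_single_one_of_weight_eq hp2 hpn hndvd h')
  · have hb0 : β 0 = 1 := by omega
    have hb1 : β 1 = 0 := by omega
    have hβ0' : β = Finsupp.single 0 1 := by
      ext i
      fin_cases i
      · simpa using hb0
      · simpa using hb1
    rw [hβ0']
    exact coeff_eq_zero_of_arc_dvd φ hφ0 hφ1 hdvd _ (weight_single_zero_lt hp2 hpn le_rfl)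
      (fun β' _ h' => eq_single_zero_of_weight_eq hp2 hpn h')

/-- [OURS · L0 K4.6; NOT a statement of the manuscript] **NO `x̄^q` EDGE GENERATOR, EVERY DEGREE `q ≥ 1`:** an element
`h` of the degree-`q` piece of `℘alg(yᵖ + xⁿ, p)` which has order `≥ q` at the origin (`h ∈ (x,y)^q`) has ZERO
coefficient at the monomial `x^q` — its initial form of degree `q` never contains `x̄^q`. (`x^q` is the unique
monomial of total degree `≥ q` and arc weight `p(p−1)q`, and `p(p−1)q < q·p(n−1)`.) Replaces the role of the K4.6
level-0 datum «no element of `℘(K_{p,n},q)` has initial form `x̄^q`» (KILL-TEST-K4.6.md §3.1 (iv), there for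
`q ∈ {p, p², p³} ≤ 64` by certificate), now for all `q`, `p`, `n` (`p < n`; `p ∤ n` not needed); NOT a statement of
the manuscript. [folklore] -/
theorem coeff_X_pow_eq_zero_of_mem_homogPiece [hp : Fact p.Prime] [CharP K p] (hpn : p < n) {q : ℕ}
    (hq : 1 ≤ q) {h : MvPolynomial (Fin 2) K}
    (hh : h ∈ homogPiece (MvPolynomial (Fin 2) K)
      (pAlgebraicRing K (MvPolynomial (Fin 2) K) (Ideal.span {(X 1 ^ p + X 0 ^ n)}) p) q)
    (hord : h ∈ MvPolynomial.idealOfVars (Fin 2) K ^ q) :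
    h.coeff (Finsupp.single 0 q) = 0 := by
  classical
  have hp2 : 2 ≤ p := hp.out.two_le
  rw [homogPiece, Submodule.mem_comap, Subalgebra.mem_toSubmodule] at hh
  set φ : MvPolynomial (Fin 2) K →ₐ[K] Polynomial K :=
    MvPolynomial.aeval ![(Polynomial.X : Polynomial K) ^ (p * (p - 1)), -Polynomial.X ^ (n * (p - 1))] with hφ
  have hφ0 : φ (X 0) = Polynomial.X ^ (p * (p - 1)) := by rw [hφ, MvPolynomial.aeval_X]; rfl
  have hφ1 : φ (X 1) = -Polynomial.X ^ (n * (p - 1)) := by rw [hφ, MvPolynomial.aeval_X]; rfl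
  have hdvd := arc_dvd_of_monomial_mem hpn φ hφ0 hφ1 hh
  rw [MvPolynomial.mem_pow_idealOfVars_iff] at hord
  refine coeff_eq_zero_of_arc_dvd φ hφ0 hφ1 hdvd _ (weight_single_zero_lt hp2 hpn hq) ?_
  intro β hβ hw
  have h1 : (Finsupp.single (0 : Fin 2) q) 0 = q := Finsupp.single_eq_same
  have h2 : (Finsupp.single (0 : Fin 2) q) 1 = 0 := by simp
  rw [h1, h2] at hw
  have hdegβ : q ≤ β 0 + β 1 := by
    have h3 := hord β hβ
    have h4 := Finsupp.degree_eq_sum β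
    rw [Fin.sum_univ_two] at h4
    omega
  have hw' : p * β 0 + n * β 1 = p * q + n * 0 := Nat.eq_of_mul_eq_mul_left (by omega) hw
  have hb1 : β 1 = 0 := by
    by_contra hne
    have h3 : (p + 1) * β 1 ≤ n * β 1 := Nat.mul_le_mul_right (β 1) hpn
    have h4 : p * q ≤ p * (β 0 + β 1) := Nat.mul_le_mul_left p hdegβ
    have h5 : p * (β 0 + β 1) = p * β 0 + p * β 1 := by ring
    have h6 : (p + 1) * β 1 = p * β 1 + β 1 := by ring
    have h7 : 1 ≤ β 1 := Nat.one_le_iff_ne_zero.mpr hne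
    omega
  have hb0 : β 0 = q := by
    rw [hb1] at hw'
    exact Nat.eq_of_mul_eq_mul_left (by omega : 0 < p) (by omega)
  ext i
  fin_cases i
  · simpa using hb0
  · simpa using hb1

end Cusp

end CampaignW46

end Summit.ResolutionOfSingularities.ResolutionOfSingularities.Theorems

end
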